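import Summits.KontsevichZagierPeriods.KontsevichZagierPeriods.Theses.HurwitzMicroSectors
import Literature.NumberTheory.Transcendental.BoxIntegralHurwitz

/-!
# `HurwitzSectorComplement` (stmt-KontsevichZagierPeriods-14341), line `galois-parity-half`:
# stub `stub_nfValue` — the value of the normal form on the open box

For a representation `r : KZ.IntegralRep w` on the open box `(0,1)^w` whose integrand agrees there
with the normal form `c + Σ_{a ∈ T_L} μ_a (t^{a−1} + (−1)^w t^{L−1−a})/(1 − t^L)`, `t = x₀⋯x_{w−1}`,
`T_L = {a < L : 2a < L, gcd(a,L) = 1}`, the value is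
`c + Σ_{a ∈ T_L} μ_a (Σ_k (Lk+a)^{−w} + (−1)^w Σ_k (Lk+L−a)^{−w})`:
linearity of the integral over the (volume-one) box and the Literature evaluation
`∫_{(0,1)^w} t^b/(1 − t^L) = Σ_k (Lk+b+1)^{−w}`
(`BoxIntegral.setIntegral_box_prod_pow_div_one_sub_prod_pow`), with `b = a − 1` and `b = L − 1 − a`.
-/

noncomputable section

open Set MeasureTheory
open scoped BigOperators
open Literature.NumberTheory.Transcendental

namespace Summit.KontsevichZagierPeriods.Theorems.HurwitzMicroSectorsHurwitzSectorComplement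

namespace NfValue

/-- The symmetric pair kernel `(t^{a−1} + (−1)^w t^{L−1−a})/(1 − t^L)`, `t = ∏ xᵢ`, is integrable on
the open unit box (`w ≥ 2`, `L ≥ 1`). [folklore] -/
theorem integrableOn_pair {w L : ℕ} (hw : 2 ≤ w) (hL : 1 ≤ L) (a : ℕ) :
    IntegrableOn (fun x : Fin w → ℝ =>
        ((∏ i, x i) ^ (a - 1) + (-1 : ℝ) ^ w * (∏ i, x i) ^ (L - 1 - a)) / (1 - (∏ i, x i) ^ L))
      {x | ∀ i, x i ∈ Ioo (0 : ℝ) 1} volume := by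
  have i1 := BoxIntegral.integrableOn_box_prod_pow_div_one_sub_prod_pow hw hL (a - 1)
  have i2 := BoxIntegral.integrableOn_box_prod_pow_div_one_sub_prod_pow hw hL (L - 1 - a)
  refine (i1.add (i2.const_mul ((-1 : ℝ) ^ w))).congr_fun (fun x _ => ?_)
    (Beukers.measurableSet_cube w)
  simp only [Pi.add_apply]
  ring

/-- **The symmetric pair integral**: for `w ≥ 2`, `1 ≤ a`, `a + 1 ≤ L`,
`∫_{(0,1)^w} (t^{a−1} + (−1)^w t^{L−1−a})/(1 − t^L) = Σ_k (Lk+a)^{−w} + (−1)^w Σ_k (Lk+(L−a))^{−w}`.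
[folklore] -/
theorem setIntegral_pair {w L a : ℕ} (hw : 2 ≤ w) (ha : 1 ≤ a) (haL : a + 1 ≤ L) :
    ∫ x in {x : Fin w → ℝ | ∀ i, x i ∈ Ioo (0 : ℝ) 1},
        ((∏ i, x i) ^ (a - 1) + (-1 : ℝ) ^ w * (∏ i, x i) ^ (L - 1 - a)) / (1 - (∏ i, x i) ^ L)
      = (∑' k : ℕ, 1 / ((L : ℝ) * k + a) ^ w)
        + (-1 : ℝ) ^ w * (∑' k : ℕ, 1 / ((L : ℝ) * k + ((L : ℝ) - a)) ^ w) := by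
  have hL : 1 ≤ L := by omega
  have i1 := BoxIntegral.integrableOn_box_prod_pow_div_one_sub_prod_pow hw hL (a - 1)
  have i2 := BoxIntegral.integrableOn_box_prod_pow_div_one_sub_prod_pow hw hL (L - 1 - a)
  have h1 := BoxIntegral.setIntegral_box_prod_pow_div_one_sub_prod_pow hw hL (a - 1)
  have h2 := BoxIntegral.setIntegral_box_prod_pow_div_one_sub_prod_pow hw hL (L - 1 - a)
  have ha' : ((a - 1 : ℕ) : ℝ) + 1 = (a : ℝ) := by
    exact_mod_cast Nat.sub_add_cancel ha
  have hLa' : ((L - 1 - a : ℕ) : ℝ) + 1 = (L : ℝ) - a := by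
    have h : ((L - 1 - a : ℕ) : ℝ) + 1 + a = L := by
      exact_mod_cast (show L - 1 - a + 1 + a = L by omega)
    linarith
  rw [setIntegral_congr_fun (Beukers.measurableSet_cube w)
      (g := fun x : Fin w → ℝ => (∏ i, x i) ^ (a - 1) / (1 - (∏ i, x i) ^ L)
        + (-1 : ℝ) ^ w * ((∏ i, x i) ^ (L - 1 - a) / (1 - (∏ i, x i) ^ L)))
      (fun x _ => by rw [add_div, mul_div_assoc]),
    integral_add i1 (i2.const_mul _), integral_const_mul, h1, h2]
  congr 1
  · exact tsum_congr fun k => by rw [add_assoc, ha']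
  · congr 1
    exact tsum_congr fun k => by rw [add_assoc, hLa']

/-- Members of `T_L = {a < L : 2a < L, gcd(a,L) = 1}` satisfy `1 ≤ a` and `a + 1 ≤ L` once `L ≥ 3`
(`gcd(0,L) = L ≠ 1`). [folklore] -/
theorem one_le_and_lt_of_mem {L a : ℕ} (hL : 3 ≤ L)
    (ha : a ∈ (Finset.range L).filter (fun a => 2 * a < L ∧ Nat.Coprime a L)) :
    1 ≤ a ∧ a + 1 ≤ L := by
  simp only [Finset.mem_filter, Finset.mem_range] at ha
  obtain ⟨haL, -, hcop⟩ := ha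
  refine ⟨?_, by omega⟩
  rcases Nat.eq_zero_or_pos a with rfl | hpos
  · rw [Nat.coprime_zero_left] at hcop
    omega
  · exact hpos

end NfValue

open NfValue in
/-- **S2 (value of the normal form).** On the open box `(0,1)^w` the normal form
`c + Σ_{a ∈ T_L} μ_a (t^{a−1} + (−1)^w t^{L−1−a})/(1 − t^L)` has value
`c + Σ_{a ∈ T_L} μ_a (Σ_k (Lk+a)^{−w} + (−1)^w Σ_k (Lk+L−a)^{−w})`. [folklore] -/
theorem stub_nfValue : ∀ (w L : ℕ) (c : ℚ) (μ : ℕ → ℚ) (r : KZ.IntegralRep w), 2 ≤ w → 3 ≤ L → r.domain = {x | ∀ i, x i ∈ Set.Ioo (0:ℝ) 1} → Set.EqOn r.integrand (fun x => (c : ℝ) + ∑ a ∈ (Finset.range L).filter (fun a => 2 * a < L ∧ Nat.Coprime a L), (μ a : ℝ) * (((∏ i, x i) ^ (a - 1) + (-1 : ℝ) ^ w * (∏ i, x i) ^ (L - 1 - a)) / (1 - (∏ i, x i) ^ L))) r.domain → r.value = (c : ℝ) + ∑ a ∈ (Finset.range L).filter (fun a => 2 * a < L ∧ Nat.Coprime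 a L), (μ a : ℝ) * ((∑' k : ℕ, 1 / ((L : ℝ) * k + a) ^ w) + (-1 : ℝ) ^ w * (∑' k : ℕ, 1 / ((L : ℝ) * k + ((L : ℝ) - a)) ^ w)) := by
  intro w L c μ r hw hL hdom hint
  have hL1 : 1 ≤ L := by omega
  have hmeas : MeasurableSet r.domain := by
    rw [hdom]
    exact Beukers.measurableSet_cube w
  have hsum : ∀ a ∈ (Finset.range L).filter (fun a => 2 * a < L ∧ Nat.Coprime a L),
      IntegrableOn (fun x : Fin w → ℝ => (μ a : ℝ)
        * (((∏ i, x i) ^ (a - 1) + (-1 : ℝ) ^ w * (∏ i, x i) ^ (L - 1 - a)) / (1 - (∏ i, x i) ^ L)))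
        {x | ∀ i, x i ∈ Ioo (0 : ℝ) 1} volume :=
    fun a _ => (integrableOn_pair hw hL1 a).const_mul _
  rw [KZ.IntegralRep.value, setIntegral_congr_fun hmeas hint, hdom,
    integral_add (BoxIntegral.integrableOn_box_const w _) (integrable_finsetSum _ hsum),
    BoxIntegral.setIntegral_box_const, integral_finsetSum _ hsum]
  congr 1
  refine Finset.sum_congr rfl fun a ha => ?_
  obtain ⟨ha1, haL⟩ := one_le_and_lt_of_mem hL ha
  rw [integral_const_mul, setIntegral_pair hw ha1 haL]

end Summit.KontsevichZagierPeriods.Theorems.HurwitzMicroSectorsHurwitzSectorComplement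

end
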